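import Mathlib
import Summits.Ventures.DiscreteObjects.Mahler.NonreciprocalStructure
import Summits.Ventures.DiscreteObjects.Mahler.OddCoefficientsMahlerBound
import Summits.Ventures.DiscreteObjects.Mahler.CongruentOneCoefficients
import Summits.Ventures.DiscreteObjects.Mahler.DobrowolskiLemma
import Summits.Ventures.DiscreteObjects.Mahler.SchinzelTotallyReal

/-!
# Unconditional kernel constraints on an irreducible sub-Lehmer polynomial (venture `DiscreteObjects`, target L)

Cell `pub-namedobj`, seat `pub-namedobj-mahler` (gen 8). Framing: lottery ticket; floor = certified
bounds/negative ranges.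

One statement collecting what the tree proves WITHOUT any named fact about a hypothetical irreducible
`P ∈ ℤ[X]` with `1 < M(P) < M(L)` (`L` = Lehmer's polynomial, `M(L) = 1.17628…`), i.e. about the object
target L is looking for (`subLehmer_irreducible_constraints`):

1. `P` is reciprocal (`P.reverse = P`) — Smyth/Breusch-type bound `M ≥ (1+√17)/4` of gen 7
   (`SmythFree.core_reverse_eq`; the full Smyth constant `θ₀` is `SmythTheorem`);
2. `deg P` is even and `≥ 2` (`SmythFree.core_even_natDegree`);
3. some coefficient of `P` is even — Borwein–Dobrowolski–Mossinghoff 2007 (`not_subLehmer_of_irreducible_odd`);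
4. for every `m` with `|m| ≥ 3`, the coefficients are not all `≡ 1 (mod m)` — [BDM07, (3.6)]
   (`not_subLehmer_of_modEq_one`);
5. `M(P)^{4 L(P)} > 2`, `L(P) = Σ|aᵢ|` the length — Mignotte 1978 / Dobrowolski's lemma
   (`two_lt_mahlerMeasure_pow_length_of_irreducible`);
6. `P` has a non-real root — Schinzel 1973 (`goldenRatio_pow_le_mahlerMeasure_sq_of_totally_real`:
   totally real would force `M(P)² ≥ φ^{deg P} ≥ φ²`).

(Conditional on [MRW08, Thm 1.1] the tree adds `deg P ≥ 56`, see `SubLehmerStructure`.)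
-/

namespace Summit.Ventures.DiscreteObjects.Mahler

open Polynomial Real

/-- An irreducible sub-Lehmer polynomial has positive degree (a constant has integer measure). -/
theorem natDegree_ne_zero_of_subLehmer_irreducible {P : ℤ[X]} (hP : SubLehmer P) : P.natDegree ≠ 0 := by
  intro hd0
  have hL := lehmer_measure_upper_bound
  have hC := eq_C_of_natDegree_eq_zero hd0
  have hM : intMahlerMeasure P = |(P.coeff 0 : ℝ)| := by
    unfold intMahlerMeasure
    rw [hC, map_C, mahlerMeasure_const, eq_intCast, Complex.norm_intCast, coeff_C_zero]
  obtain ⟨h1, h2⟩ := hP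
  rw [hM] at h1 h2
  have h3 : (2 : ℝ) ≤ |(P.coeff 0 : ℝ)| := by
    have h1' : (1 : ℤ) < |P.coeff 0| := by exact_mod_cast h1
    have : (2 : ℤ) ≤ |P.coeff 0| := h1'
    exact_mod_cast this
  linarith

/-- **Kernel constraints on an irreducible sub-Lehmer polynomial** (all unconditional; see the module
docstring for the sources of 1–6). -/
theorem subLehmer_irreducible_constraints {P : ℤ[X]} (hirr : Irreducible P) (hP : SubLehmer P) :
    P.reverse = P ∧
    (Even P.natDegree ∧ 2 ≤ P.natDegree) ∧
    (∃ i ≤ P.natDegree, ¬ Odd (P.coeff i)) ∧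
    (∀ m : ℤ, 3 ≤ |m| → ∃ i ≤ P.natDegree, ¬ (m ∣ P.coeff i - 1)) ∧
    (2 : ℝ) < intMahlerMeasure P ^ (4 * ∑ i ∈ Finset.range (P.natDegree + 1), (P.coeff i).natAbs) ∧
    (∃ α ∈ (P.map (Int.castRingHom ℂ)).roots, α.im ≠ 0) := by
  have hcf : ∀ n : ℕ, 0 < n → ¬ cyclotomic n ℤ ∣ P := fun n hn => core_not_cyclotomic_dvd hirr hP hn
  have h0 : P.coeff 0 ≠ 0 := core_coeff_zero_ne_zero hirr hP
  have hd0 : P.natDegree ≠ 0 := natDegree_ne_zero_of_subLehmer_irreducible hP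
  have heven : Even P.natDegree := SmythFree.core_even_natDegree hirr hP
  have hd2 : 2 ≤ P.natDegree := by
    obtain ⟨k, hk⟩ := heven
    omega
  refine ⟨SmythFree.core_reverse_eq hirr hP, ⟨heven, hd2⟩, ?_, ?_, ?_, ?_⟩
  · -- an even coefficient (BDM 2007)
    by_contra hall
    push Not at hall
    exact not_subLehmer_of_irreducible_odd hirr hall hP
  · -- not all `≡ 1 (mod m)`, `|m| ≥ 3`
    intro m hm
    by_contra hall
    push Not at hall
    exact not_subLehmer_of_modEq_one hm hall hcf hP
  · -- Mignotte
    exact two_lt_mahlerMeasure_pow_length_of_irreducible hirr (by omega) h0 hcf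
  · -- a non-real root (Schinzel)
    by_contra hall
    push Not at hall
    have h1 : P.eval 1 ≠ 0 := by
      intro h
      apply hcf 1 one_pos
      rw [cyclotomic_one]
      exact dvd_iff_isRoot.mpr h
    have hm1 : P.eval (-1) ≠ 0 := by
      intro h
      apply hcf 2 two_pos
      rw [cyclotomic_two]
      have : (X + 1 : ℤ[X]) = X - C (-1) := by simp
      rw [this]
      exact dvd_iff_isRoot.mpr h
    have hS := goldenRatio_pow_le_mahlerMeasure_sq_of_totally_real h0 h1 hm1 hall
    have hL := lehmer_measure_upper_bound
    obtain ⟨hM1, hM2⟩ := hP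
    have hM0 : 0 ≤ intMahlerMeasure P := by linarith
    have hsq : intMahlerMeasure P ^ 2 < (6 / 5 : ℝ) ^ 2 :=
      pow_lt_pow_left₀ (by linarith) hM0 two_ne_zero
    -- `φ² ≤ φ^{deg P}` and `φ² = φ + 1 > 2.6`
    have hφ1 : 1 ≤ goldenRatio := Real.one_lt_goldenRatio.le
    have hφd : goldenRatio ^ 2 ≤ goldenRatio ^ P.natDegree := pow_le_pow_right₀ hφ1 hd2
    have hφ2 : goldenRatio ^ 2 = goldenRatio + 1 := Real.goldenRatio_sq
    have hφgt : (1.6 : ℝ) < goldenRatio := by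
      have := Real.goldenRatio_irrational
      rw [Real.goldenRatio]
      have h5 : (2.2 : ℝ) < √5 := by
        rw [show (2.2 : ℝ) = √(2.2 ^ 2) by rw [Real.sqrt_sq (by norm_num)]]
        exact Real.sqrt_lt_sqrt (by norm_num) (by norm_num)
      linarith
    nlinarith

end Summit.Ventures.DiscreteObjects.Mahler
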